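/-
Copyright (c) 2026 the pub-hodgecm-mathlib formalisation cell (harness21).  Track B «K2-LIT» prover seat hodgecm-mathlib-K2E3-p15 (g3) (road R3 ∕ ‹J3› owner), 2026-09-04:
‹S› ROAD J, road (d-w) of K2E3-p03 (g3) — THE (C1) CLOSER: the wild isotropic residual count `N_iso` from the Iwahori level count (C1-I) and the two edge indices `[K⁰ : I]`.
-/
import Summits.HodgeConjecture.HodgeConjecture.Theorems.K2E3EPIndicesWild                            -- ★ W2 p856841 (K2E3-p03 g3): `relIndex_sharp_inf_level_eq_of_antifixed_unit` (√u `[K⁰:I] = q+1`); brings ★ (E-ram) `…_of_antifixed_uniformizer` (√π `[K⁰:I] = 2`), `mem_comap_map_conj_glInt_iff`, `forall_v_sharp_iff_coe_mem_map_conj`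
import Literature.NumberTheory.Automorphic.UnitaryTwoVertexEdgeStabilizerMassRatioRamified         -- ★ LH4-p05: `sharp_iff_v_apply_one_zero_lt_one_of_mem`
import Literature.NumberTheory.Weil1982.UnitaryFinTopFormLieGramWildLieSide                         -- ★ p857013: the `levelOf … (ballMat p)` currency of (C1) (brings ★ R3a-1, ★ `UnitaryFinCayleyWindow`)
import Literature.NumberTheory.Weil1982.UnitaryFinTopFormUnimodularLieLattice                       -- ★ (HS-A): `levelOf_ballMat_le_inf_level`
import Literature.NumberTheory.Automorphic.RamifiedPlaceBlockWild                                   -- ★ `exists_valued_eq_exp_neg_one` (a uniformiser of `L_w`)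
import Literature.NumberTheory.Automorphic.AdelicAdditiveCharacterGaloisTwist                        -- ★ `valued_natCast_lt_one_of_mem` (`2 ∈ v ⇒ |2|_v < 1`)
import Literature.NumberTheory.Automorphic.Liu2021.LemD1AsPrintedIndexedNonVacuityTameSynthesis          -- ★ `isUnramifiedIn_of_ramificationIdx'_eq_one`
import HarnessLib

/-!
# (C1) «wild isotropic residual count» ⟸ (C1-I) «Iwahori level count»: `N_iso = [K⁰ : I]·[I : K⁰(4)]` at a wildly ramified dyadic place (Tits 1979 §3.7; Kottwitz 1988 §1)

Cell `pub/hodgecm-mathlib`, crux H413 = `stmt-HodgeConjecture-24833` (supports-only, `--as helper`), Track B E3∕E4 junction ‹S›, ROAD J, letter ‹J3› v2 — road (d-w) (owner K2E3-p03 (g3)),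
deal «(C1) closer» (03:33:10Z).  The chain so far: ‹J3› v2 ⟸ (J3d-w) ⟸ (W3) ⟸★ p857062 (C-ratio) ⟸★ p857088 {(C1), (C2)}.  THIS FILE reduces the isotropic count letter **(C1)**
`sig_K2E3WildIsotropicResidualCount` (K2E3-p03 (g3) cand b9fc21fc, statement VERBATIM as the conclusion: `N_iso = [K⁰ : K⁰(4)] = 2(q−1)q^{8m−1}` at type √π, `(q−1)(q+1)q^{8m−2}` at type √u,
`K⁰ = U(Φ₂)(𝒪_v)`, `K⁰(4) =` ★ R3a-1's `levelOf 1 (ballMat p)`, `|2|_v = q^{−m}`) to K2E4-p09 (g3)'s **(C1-I) «IWAHORI LEVEL COUNT»** (REPORT-FIRST head 03:33:13Z, road owner «=» 03:34:55Z; taken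
here as the CLOSED hypothesis `hCI`, binder for binder): `[I : K⁰(4)] = (q−1)·q^{8m−2+s}` for any subgroup `I` with membership letter `g ∈ K⁰ ∧ |(E₂ g)₁₀|_w < 1` (the IWAHORI subgroup of the
edge), `s ∈ {0,1}` the valuation of the anti-fixed type key `α` (`s = 1` √π, `s = 0` √u).
THE PROOF.  `N_iso = [K⁰ : K⁰(4)] = [K⁰ : I]·[I : K⁰(4)]` (Mathlib `Subgroup.relIndex_mul_relIndex`; `Z(1) = ⊤`) with `I := K♯_η ⊓ K⁰`, `K♯_η` J2♯'s end-vertex stabiliser in the comap spelling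
of ★ (E-ram)∕★ W2 (`η = α` at √π, any uniformiser at √u): `hI` by ★ `mem_comap_map_conj_glInt_iff` + ★ `forall_v_sharp_iff_coe_mem_map_conj` + ★ `sharp_iff_v_apply_one_zero_lt_one_of_mem`;
`K⁰(4) ≤ I` since `mat g − 1 ∈ 2p·M` forces `|(E₂ g)₁₀|_w ≤ |2p|_w < 1` (★ `twoBall_ballMat`, ★ `coe_localNonsplitEquiv_apply` rfl); **`[K⁰ : I] = 2`** at √π (★ (E-ram)
`relIndex_sharp_inf_level_eq_of_antifixed_uniformizer`) and **`= q + 1`** at √u (★ W2 `relIndex_sharp_inf_level_eq_of_antifixed_unit`) — the vertex∕edge valencies of the tree of `U(1,1)` at a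
ramified place [Tits1979 §3.7]; `m ≥ 1` from `2 ∈ v`; ℕ arithmetic.  So after PART C hosts (C1-I) and re-ties (C1) through `isoCount_of_iwahoriCount`, ‹J3› v2 is ★ modulo {(C1-I), (C2)}.
HONEST LABEL: `--supports stmt-HodgeConjecture-24833 --as helper`, count-neutral; (C1) is NOT proved here — it is REDUCED to (C1-I); HC_CM is proved only modulo the 7 printed citations
(2 remaining named inputs: hLiu418 = `stmt-HodgeConjecture-24832`, h413 = `stmt-HodgeConjecture-24833`) until rung 0 closes.

## References
* [Tits1979] J. Tits, *Reductive groups over local fields*, Proc. Symp. Pure Math. 33.1 (1979), §3.7 (Iwahori subgroup, valencies of the tree of `SU(2,1)`∕`U(1,1)` at a ramified place).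
* [Kottwitz1988] R. E. Kottwitz, *Tamagawa numbers*, Ann. of Math. 127 (1988), §1 Thm. 1, §2 Thm. 2.
* [Serre1980Trees] J.-P. Serre, *Trees* (1980), Ch. II §1.3.
* [PlatonovRapinchuk1994] V. Platonov, A. Rapinchuk, *Algebraic Groups and Number Theory* (1994), §3.3, §5.1.
-/

set_option autoImplicit false
set_option linter.dupNamespace false

noncomputable section

open NumberField IsDedekindDomain MeasureTheory
open Literature.NumberTheory.Automorphic Literature.NumberTheory.Automorphic.UnitaryGroup Literature.NumberTheory.Rogawski1990
open Literature.NumberTheory.Weil1982.UnitaryFinTopForm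
open scoped MatrixGroups Matrix NNReal

namespace Summit.HodgeConjecture.HodgeConjecture.Cruxes.H413.K2E3WildIsotropicResidualCountOfIwahori

open Summit.HodgeConjecture.HodgeConjecture.Cruxes.H413
open Summit.HodgeConjecture.HodgeConjecture.Cruxes.H413.K2E3EPIndicesWild (relIndex_sharp_inf_level_eq_of_antifixed_unit)
open Summit.HodgeConjecture.HodgeConjecture.Cruxes.H413.K2E3EPIndicesRamified (relIndex_sharp_inf_level_eq_of_antifixed_uniformizer)

section Iwahori

variable (L : Type) [Field L] [NumberField L] [IsCMField L] (v : HeightOneSpectrum (𝓞 ↥(maximalRealSubfield L)))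
  (w : PlacesOver L v) (hw : IsCMField.complexConj L • w.1 = w.1)

include hw in
/-- **The membership letter of `I := K♯_η ⊓ K⁰`**: `g ∈ K♯_η ⊓ K⁰ ↔ g ∈ K⁰ ∧ |(E₂ g)₁₀|_w < 1` (`η` a uniformiser of `L_w`; ★ `mem_comap_map_conj_glInt_iff`, ★ `forall_v_sharp_iff_coe_mem_map_conj`,
★ `sharp_iff_v_apply_one_zero_lt_one_of_mem`). [cite: Tits1979, §3.7] [cite: Serre1980Trees, Ch. II §1.3] -/
theorem mem_sharp_inf_level_iff (η : (w.1.adicCompletion L)ˣ) (hη : Valued.v (η : w.1.adicCompletion L) = WithZero.exp (-1 : ℤ))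
    (g : (cmDatum L 2 (Matrix.of fun i j : Fin 2 => if i.val + j.val + 1 = 2 then (1 : L) else 0)).Local v) :
    g ∈ (((glInt 2 (w.1.adicCompletion L)).map (MulAut.conj (glDiagonal 2 (w.1.adicCompletion L) ![1, η])).toMonoidHom).comap
          (((unitaryGroupOfForm (galAdicCompletionMap (L := L) (IsCMField.complexConj L) hw) (placeForm (Matrix.of fun i j : Fin 2 => if i.val + j.val + 1 = 2 then (1 : L) else 0) w.1)).subtype.comp
            (localNonsplitEquiv (IsCMField.complexConj L) (Matrix.of fun i j : Fin 2 => if i.val + j.val + 1 = 2 then (1 : L) else 0) (IsCMField.complexConj_ne_one L) w hw).toMonoidHom :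
            (cmDatum L 2 (Matrix.of fun i j : Fin 2 => if i.val + j.val + 1 = 2 then (1 : L) else 0)).Local v →* GL (Fin 2) (w.1.adicCompletion L)))) ⊓
        cmLocalIntegralLevel L 2 (Matrix.of fun i j : Fin 2 => if i.val + j.val + 1 = 2 then (1 : L) else 0) v ↔
      g ∈ cmLocalIntegralLevel L 2 (Matrix.of fun i j : Fin 2 => if i.val + j.val + 1 = 2 then (1 : L) else 0) v ∧
        Valued.v ((((((localNonsplitEquiv (IsCMField.complexConj L) (Matrix.of fun i j : Fin 2 => if i.val + j.val + 1 = 2 then (1 : L) else 0) (IsCMField.complexConj_ne_one L) w hw) g : ↥(unitaryGroupOfForm (galAdicCompletionMap (L := L) (IsCMField.complexConj L) hw) (placeForm (Matrix.of fun i j : Fin 2 => if i.val + j.val + 1 = 2 then (1 : L) else 0) w.1)))) : GL (Fin 2) (w.1.adicCompletion L)) : Matrix (Fin 2) (Fin 2) (w.1.adicCompletion L)) 1 0) < 1 := by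
  have hKs := (mem_comap_map_conj_glInt_iff L w hw (glDiagonal 2 (w.1.adicCompletion L) ![1, η]) g).trans
    (forall_v_sharp_iff_coe_mem_map_conj L w hw η ((localNonsplitEquiv (IsCMField.complexConj L) (Matrix.of fun i j : Fin 2 => if i.val + j.val + 1 = 2 then (1 : L) else 0) (IsCMField.complexConj_ne_one L) w hw) g)).symm
  rw [Subgroup.mem_inf]
  constructor
  · rintro ⟨hs, h0⟩
    exact ⟨h0, (sharp_iff_v_apply_one_zero_lt_one_of_mem L v w hw (η : w.1.adicCompletion L) hη g h0).1 (hKs.1 hs)⟩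
  · rintro ⟨h0, h10⟩
    exact ⟨hKs.2 ((sharp_iff_v_apply_one_zero_lt_one_of_mem L v w hw (η : w.1.adicCompletion L) hη g h0).2 h10), h0⟩

include hw in
/-- **`K⁰(4) ≤ I`**: a matrix `g ≡ 1 (mod 2p·M₂(𝒪))` is integral and its `(1,0)` entry has `|(E₂ g)₁₀|_w ≤ |2p|_w < 1` (★ `twoBall_ballMat`, ★ `levelOf_ballMat_le_inf_level`,
★ `valued_resChar_apply_lt_one`). [cite: PlatonovRapinchuk1994, §3.3] [cite: Tits1979, §3.7] -/
theorem levelOf_ballMat_resChar_le (ha : ∀ w' : PlacesOver L v, Valued.v (((resChar L v : ℕ) : LocalRing L v) w') < 1)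
    (I : Subgroup ((cmDatum L 2 (Matrix.of fun i j : Fin 2 => if i.val + j.val + 1 = 2 then (1 : L) else 0)).Local v))
    (hI : ∀ g : (cmDatum L 2 (Matrix.of fun i j : Fin 2 => if i.val + j.val + 1 = 2 then (1 : L) else 0)).Local v,
      g ∈ I ↔ g ∈ cmLocalIntegralLevel L 2 (Matrix.of fun i j : Fin 2 => if i.val + j.val + 1 = 2 then (1 : L) else 0) v ∧
        Valued.v ((((((localNonsplitEquiv (IsCMField.complexConj L) (Matrix.of fun i j : Fin 2 => if i.val + j.val + 1 = 2 then (1 : L) else 0) (IsCMField.complexConj_ne_one L) w hw) g : ↥(unitaryGroupOfForm (galAdicCompletionMap (L := L) (IsCMField.complexConj L) hw) (placeForm (Matrix.of fun i j : Fin 2 => if i.val + j.val + 1 = 2 then (1 : L) else 0) w.1)))) : GL (Fin 2) (w.1.adicCompletion L)) : Matrix (Fin 2) (Fin 2) (w.1.adicCompletion L)) 1 0) < 1) :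
    levelOf L 2 (Matrix.of fun i j : Fin 2 => if i.val + j.val + 1 = 2 then (1 : L) else 0) v 1 (ballMat L 2 v ((resChar L v : ℕ) : LocalRing L v)) (ballMat_mul_closed L 2 v (mem_localIntegers_of_forall_valued_lt_one L v ha)) ≤ I := by
  intro g hg
  have haO : ((resChar L v : ℕ) : LocalRing L v) ∈ localIntegers L v := mem_localIntegers_of_forall_valued_lt_one L v ha
  have hK0 := (Subgroup.mem_inf.1 (levelOf_ballMat_le_inf_level L 2 (Matrix.of fun i j : Fin 2 => if i.val + j.val + 1 = 2 then (1 : L) else 0) v 1 haO hg)).2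
  refine (hI g).2 ⟨hK0, ?_⟩
  obtain ⟨-, h1, -⟩ := (mem_levelOf_iff L 2 (Matrix.of fun i j : Fin 2 => if i.val + j.val + 1 = 2 then (1 : L) else 0) v 1 _ _ g).1 hg
  rw [twoBall_ballMat] at h1
  obtain ⟨X, hX, hXe⟩ := (mem_ballMat_iff L 2 v _ _).1 h1
  -- the `(1,0)` entry of `mat g` is `(2p)·X₁₀`
  have h10 : (mat L 2 (Matrix.of fun i j : Fin 2 => if i.val + j.val + 1 = 2 then (1 : L) else 0) v g) 1 0 = (2 * ((resChar L v : ℕ) : LocalRing L v)) * X 1 0 := by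
    have e := congr_fun (congr_fun hXe 1) 0
    rw [Matrix.smul_apply, smul_eq_mul, Matrix.sub_apply, Matrix.one_apply_ne (by decide), sub_zero] at e
    exact e.symm
  have hXw : Valued.v (X 1 0 w) ≤ 1 :=
    (Literature.NumberTheory.Weil1982.UnitaryFinTopForm.mem_integer_iff_valued_le_one L v w _).1 ((mem_localIntegers_iff L v _).1 ((mem_intMatrices_iff L 2 v X).1 hX 1 0) w)
  have h2w : Valued.v ((2 : LocalRing L v) w) ≤ 1 :=
    (Literature.NumberTheory.Weil1982.UnitaryFinTopForm.mem_integer_iff_valued_le_one L v w _).1 ((mem_localIntegers_iff L v _).1 (two_mem_localIntegers L v) w)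
  show Valued.v ((mat L 2 (Matrix.of fun i j : Fin 2 => if i.val + j.val + 1 = 2 then (1 : L) else 0) v g) 1 0 w) < 1
  rw [h10, Pi.mul_apply, Pi.mul_apply, map_mul, map_mul]
  calc Valued.v ((2 : LocalRing L v) w) * Valued.v (((resChar L v : ℕ) : LocalRing L v) w) * Valued.v (X 1 0 w)
      ≤ 1 * Valued.v (((resChar L v : ℕ) : LocalRing L v) w) * 1 := by gcongr
    _ < 1 := by rw [one_mul, mul_one]; exact ha w

end Iwahori

open Set Matrix Literature.NumberTheory.Automorphic.UnitaryGroup Literature.NumberTheory.GaloisRepresentations in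
open scoped NNReal Classical in
/-- **(C1) «WILD ISOTROPIC RESIDUAL COUNT» FROM (C1-I) «IWAHORI LEVEL COUNT».**  Conclusion = K2E3-p03 (g3)'s letter (C1) `sig_K2E3WildIsotropicResidualCount` VERBATIM (`N_iso = [K⁰ : K⁰(4)]
= 2(q−1)q^{8m−1}` at √π, `(q−1)(q+1)q^{8m−2}` at √u); hypothesis `hCI` = K2E4-p09 (g3)'s (C1-I) head as a closed letter (`[I : K⁰(4)] = (q−1)·q^{8m−2+s}` for the Iwahori subgroup `I` of
the edge, `s` the valuation of the type key).  Proof: `I := K♯_η ⊓ K⁰` per type, `[K⁰ : K⁰(4)] = [K⁰ : I]·[I : K⁰(4)]`, `[K⁰ : I] ∈ {2, q+1}` (★ (E-ram) ∕ ★ W2), `m ≥ 1`, arithmetic.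
[cite: Tits1979, §3.7] [cite: Serre1980Trees, Ch. II §1.3] [cite: Kottwitz1988, §1 Thm. 1, §2 Thm. 2] [cite: PlatonovRapinchuk1994, §3.3] -/
theorem isoCount_of_iwahoriCount
    (hCI :
      ∀ (L : Type) [Field L] [NumberField L] [IsCMField L] (v : HeightOneSpectrum (𝓞 ↥(maximalRealSubfield L)))
        (w : UnitaryGroup.PlacesOver L v) (hw : IsCMField.complexConj L • w.1 = w.1),
        v.asIdeal.ramificationIdx' w.1.asIdeal ≠ 1 → (2 : 𝓞 ↥(maximalRealSubfield L)) ∈ v.asIdeal →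
        ∀ (m s : ℕ), Valued.v (2 : v.adicCompletion ↥(maximalRealSubfield L)) = WithZero.exp (-(m : ℤ)) → s ≤ 1 →
        (∃ α : w.1.adicCompletion L, galAdicCompletionMap (L := L) (IsCMField.complexConj L) hw α = -α ∧ Valued.v α = WithZero.exp (-(s : ℤ))) →
        ∀ (ha : ∀ w' : UnitaryGroup.PlacesOver L v, Valued.v (((resChar L v : ℕ) : UnitaryGroup.LocalRing L v) w') < 1)
          (I : Subgroup ((UnitaryGroup.cmDatum L 2 (Matrix.of fun i j : Fin 2 => if i.val + j.val + 1 = 2 then (1 : L) else 0)).Local v)),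
        (∀ g : (UnitaryGroup.cmDatum L 2 (Matrix.of fun i j : Fin 2 => if i.val + j.val + 1 = 2 then (1 : L) else 0)).Local v,
            g ∈ I ↔ g ∈ cmLocalIntegralLevel L 2 (Matrix.of fun i j : Fin 2 => if i.val + j.val + 1 = 2 then (1 : L) else 0) v ∧
              Valued.v ((((((localNonsplitEquiv (IsCMField.complexConj L) (Matrix.of fun i j : Fin 2 => if i.val + j.val + 1 = 2 then (1 : L) else 0) (IsCMField.complexConj_ne_one L) w hw) g : ↥(unitaryGroupOfForm (galAdicCompletionMap (L := L) (IsCMField.complexConj L) hw) (placeForm (Matrix.of fun i j : Fin 2 => if i.val + j.val + 1 = 2 then (1 : L) else 0) w.1)))) : GL (Fin 2) (w.1.adicCompletion L)) : Matrix (Fin 2) (Fin 2) (w.1.adicCompletion L)) 1 0) < 1) →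
        (levelOf L 2 (Matrix.of fun i j : Fin 2 => if i.val + j.val + 1 = 2 then (1 : L) else 0) v 1 (ballMat L 2 v ((resChar L v : ℕ) : UnitaryGroup.LocalRing L v)) (ballMat_mul_closed L 2 v (mem_localIntegers_of_forall_valued_lt_one L v ha))).relIndex I =
          (Nat.card (𝓞 ↥(maximalRealSubfield L) ⧸ v.asIdeal) - 1) * Nat.card (𝓞 ↥(maximalRealSubfield L) ⧸ v.asIdeal) ^ (8 * m - 2 + s)) :

    ∀ (L : Type) [Field L] [NumberField L] [IsCMField L] (v : HeightOneSpectrum (𝓞 ↥(maximalRealSubfield L)))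
      (w : UnitaryGroup.PlacesOver L v) (hw : IsCMField.complexConj L • w.1 = w.1),
      (2 : 𝓞 ↥(maximalRealSubfield L)) ∈ v.asIdeal → ¬ Algebra.IsUnramifiedIn (𝓞 L) v.asIdeal →
      ∀ (m : ℕ), Valued.v (2 : v.adicCompletion ↥(maximalRealSubfield L)) = WithZero.exp (-(m : ℤ)) →
      ∀ (ha : ∀ w' : UnitaryGroup.PlacesOver L v, Valued.v (((resChar L v : ℕ) : UnitaryGroup.LocalRing L v) w') < 1)
        (α : (w.1.adicCompletion L)ˣ), galAdicCompletionMap (L := L) (IsCMField.complexConj L) hw (α : w.1.adicCompletion L) = -(α : w.1.adicCompletion L) →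
      (Valued.v (α : w.1.adicCompletion L) = WithZero.exp (-1 : ℤ) →
        (levelOf L 2 (Matrix.of fun i j : Fin 2 => if i.val + j.val + 1 = 2 then (1 : L) else 0) v 1
                (ballMat L 2 v ((resChar L v : ℕ) : UnitaryGroup.LocalRing L v)) (ballMat_mul_closed L 2 v (mem_localIntegers_of_forall_valued_lt_one L v ha))).relIndex
              (Subgroup.centralizer ({(1 : (UnitaryGroup.cmDatum L 2 (Matrix.of fun i j : Fin 2 => if i.val + j.val + 1 = 2 then (1 : L) else 0)).Local v)} : Set _) ⊓
                cmLocalIntegralLevel L 2 (Matrix.of fun i j : Fin 2 => if i.val + j.val + 1 = 2 then (1 : L) else 0) v) =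
          2 * (Nat.card (𝓞 ↥(maximalRealSubfield L) ⧸ v.asIdeal) - 1) * Nat.card (𝓞 ↥(maximalRealSubfield L) ⧸ v.asIdeal) ^ (8 * m - 1)) ∧
      (Valued.v (α : w.1.adicCompletion L) = 1 →
        (levelOf L 2 (Matrix.of fun i j : Fin 2 => if i.val + j.val + 1 = 2 then (1 : L) else 0) v 1
                (ballMat L 2 v ((resChar L v : ℕ) : UnitaryGroup.LocalRing L v)) (ballMat_mul_closed L 2 v (mem_localIntegers_of_forall_valued_lt_one L v ha))).relIndex
              (Subgroup.centralizer ({(1 : (UnitaryGroup.cmDatum L 2 (Matrix.of fun i j : Fin 2 => if i.val + j.val + 1 = 2 then (1 : L) else 0)).Local v)} : Set _) ⊓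
                cmLocalIntegralLevel L 2 (Matrix.of fun i j : Fin 2 => if i.val + j.val + 1 = 2 then (1 : L) else 0) v) =
          (Nat.card (𝓞 ↥(maximalRealSubfield L) ⧸ v.asIdeal) - 1) * (Nat.card (𝓞 ↥(maximalRealSubfield L) ⧸ v.asIdeal) + 1) * Nat.card (𝓞 ↥(maximalRealSubfield L) ⧸ v.asIdeal) ^ (8 * m - 2)) := by
  intro L _ _ _ v w hw h2v hram m hm ha α hα
  classical
  have hc1 : IsCMField.complexConj L ≠ 1 := IsCMField.complexConj_ne_one L
  have he : v.asIdeal.ramificationIdx' w.1.asIdeal ≠ 1 := fun h1 =>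
    hram (Literature.NumberTheory.Automorphic.Liu2021.LemD1IndexedNonVacuityTameSynthesis.isUnramifiedIn_of_ramificationIdx'_eq_one L (IsCMField.complexConj L) v hc1 w hw h1)
  -- `m ≥ 1` (`2 ∈ v`), `q ≥ 2`
  have hm1 : 1 ≤ m := by
    have h2lt : Valued.v (2 : v.adicCompletion ↥(maximalRealSubfield L)) < 1 := by
      have h := valued_natCast_lt_one_of_mem ↥(maximalRealSubfield L) v (ℓ := 2) (by exact_mod_cast h2v)
      exact_mod_cast h
    rw [hm, ← WithZero.exp_zero, WithZero.exp_lt_exp] at h2lt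
    omega
  -- `Z(1) ⊓ K⁰ = K⁰`
  have hZ : Subgroup.centralizer ({(1 : (cmDatum L 2 (Matrix.of fun i j : Fin 2 => if i.val + j.val + 1 = 2 then (1 : L) else 0)).Local v)} : Set _) ⊓ cmLocalIntegralLevel L 2 (Matrix.of fun i j : Fin 2 => if i.val + j.val + 1 = 2 then (1 : L) else 0) v =
      cmLocalIntegralLevel L 2 (Matrix.of fun i j : Fin 2 => if i.val + j.val + 1 = 2 then (1 : L) else 0) v :=
    inf_eq_right.2 fun g _ => Subgroup.mem_centralizer_singleton_iff.2 (by rw [mul_one, one_mul])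
  rw [hZ]
  refine ⟨fun hvα => ?_, fun hvα => ?_⟩
  · -- type √π: `η := α`, `s = 1`, `[K⁰ : I] = 2`
    set η : (w.1.adicCompletion L)ˣ := α with hηdef
    have hI := mem_sharp_inf_level_iff L v w hw η hvα
    have hCI' := hCI L v w hw he h2v m 1 hm le_rfl ⟨(α : w.1.adicCompletion L), hα, by rw [hvα, Nat.cast_one]⟩ ha _ hI
    have hle := levelOf_ballMat_resChar_le L v w hw ha _ hI
    have h2 := (relIndex_sharp_inf_level_eq_of_antifixed_uniformizer L w hw he α hα hvα).2
    rw [← Subgroup.relIndex_mul_relIndex _ _ _ hle inf_le_right, hCI', h2]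
    have e : 8 * m - 2 + 1 = 8 * m - 1 := by omega
    rw [e]; ring
  · -- type √u: `η` any uniformiser, `s = 0`, `[K⁰ : I] = q + 1`
    obtain ⟨τ, hτ⟩ := UnitaryGroup.exists_valued_eq_exp_neg_one L v w
    have hτ0 : τ ≠ 0 := fun h0 => by rw [h0, map_zero] at hτ; exact WithZero.zero_ne_coe hτ
    set η : (w.1.adicCompletion L)ˣ := Units.mk0 τ hτ0 with hηdef
    have hη : Valued.v (η : w.1.adicCompletion L) = WithZero.exp (-1 : ℤ) := hτ
    have hI := mem_sharp_inf_level_iff L v w hw η hη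
    have hCI' := hCI L v w hw he h2v m 0 hm zero_le_one ⟨(α : w.1.adicCompletion L), hα, by rw [hvα, Nat.cast_zero, neg_zero, WithZero.exp_zero]⟩ ha _ hI
    have hle := levelOf_ballMat_resChar_le L v w hw ha _ hI
    have h2 := (relIndex_sharp_inf_level_eq_of_antifixed_unit L w hw he hvα hα η hη).2
    rw [← Subgroup.relIndex_mul_relIndex _ _ _ hle inf_le_right, hCI', h2, add_zero]
    ring

end Summit.HodgeConjecture.HodgeConjecture.Cruxes.H413.K2E3WildIsotropicResidualCountOfIwahori

end
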